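import Summits.ResolutionOfSingularities.ResolutionOfSingularities.Theorems.HilbertSamuelEliminationSigmaMaxModificationsCorridor3SigmaIsoReaches
import Summits.ResolutionOfSingularities.ResolutionOfSingularities.Theorems.HilbertSamuelEliminationSigmaMaxModificationsCorridor3WLadderStrataLineages
import HarnessLib

/-!
# [OURS · L1 W4.2] σ-LAYER — Ω-TRANSPORT brick 1: the COMBINATORIAL SPINE of the strata-half OVER AN ARBITRARY STRATEGY σ
# (step projections, components through the chain points, Kőnig: (b)σ ∧ (c)σ ⇒ no moving never-isolated σ-chain)

Crux chain w42 (`SigmaMaxModifications`, stmt-ResolutionOfSingularities-18506; conjunct `SigmaMaxModificationsCorridor3`,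
stmt-ResolutionOfSingularities-19249), res-L1-w42-plan-1 RULING v3.14-12 (BR-6) «Ω-transports of the W-low rows (4) — 040». Typer res-type-040
(gen 18). This is the σ-copy of res-L1-w42-stub-4's `…Corridor3WLadderStrataLineages` (p500484) §1–§3 over res-D-pv-047's σ-steps
(`…Corridor3SigmaStepDefs` p519751: `Sigma.Strategy`, `CanonicalNearStepσ`, `Reachesσ`, `IsBlownUpσ`, `MaxOriginNoMovingNearChainAtQσ`): its
content is STRATEGY-FREE (V8-b′ memo class (A)) — the oracle binder of the CJS rows is simply replaced by the strategy PARAMETER σ, and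
uniqueness of the step projection asks σ to be functional (`Strategy.IsFunctional`, 047). Every `theorem` is PROVED; the two `def … : Prop`
rows (b)σ / (c)σ are the σ-copies of stub-4's (b) / (c). OURS (cell res-hironaka, slot W4.2); NOT statements of H. Hironaka's manuscript
[Hironaka2017] nor of [CossartJannsenSaito2020]; AI-drafted, weaker than expert review. Helper file `--supports stmt-ResolutionOfSingularities-19249`
(counted 0).

Contents (namespace `…Theorems.SigmaMaxModificationsCorridor3.Sigma`): API of res-type-012's `StepProjectionσ` (p523704) (`CanonicalNearStepσ.exists_stepProjectionσ`,
`StepProjectionσ.canonicalNearStepσ` / `.base_pt` / `.pt_mem_hsStratum` / `.unique` (functional σ) / `.closure_image_mem_componentsThrough`),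
`exists_overField_of_canonicalNearStepσ` / `_of_reachesσ` (res-type-012's `CanonicalNearStepσ.pt_mem_hsStratum` / `pt_mem_hsStratum_of_reachesσ` of `…Corridor3SigmaIsoReaches` p525402 reused),
`isNoetherian_of_reachesσ_init`, rows `StrataBirthsSettleσ σ p N Q G` ((b)σ) and `StrataLineagesFiniteσ σ p N Q G` ((c)σ), and the PROVED
Kőnig reduction `maxOriginNoMovingNearChainAtQσ_notIso_of_lineages : (b)σ → (c)σ → MaxOriginNoMovingNearChainAtQσ σ p N Q (G ∧ ¬Iso)`;
`Iff.rfl`-grade transports `strataBirthsSettle_iff_forall_cjs` / `strataLineagesFinite_iff_forall_cjs` back to stub-4's rows.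
References: tree `…WLadderStrataLineages` (p500484; Kőnig `exists_section_of_finite_nonempty`, `componentsThrough`), `…Corridor3SigmaStepDefs`
(p519751); CJS LNM 2270 Rem. 6.29 (1), p. 105 [CossartJannsenSaito2020]; Görtz–Wedhorn I Prop. 13.96 (1) [GortzWedhorn2020].
-/

noncomputable section

set_option linter.dupNamespace false

open CategoryTheory AlgebraicGeometry TopologicalSpace Topology
open Summit.ResolutionOfSingularities.ResolutionOfSingularities.Theorems.CampaignW42
open Literature.AlgebraicGeometry.Resolution Literature.RingTheory.HilbertSamuel
open Summit.ResolutionOfSingularities.ResolutionOfSingularities.Theorems.SigmaMaxModificationsCorridor3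
open Summit.ResolutionOfSingularities.ResolutionOfSingularities.Theorems.SigmaMaxModificationsCorridor3.Moving

namespace Summit.ResolutionOfSingularities.ResolutionOfSingularities.Theorems.SigmaMaxModificationsCorridor3.Sigma

universe u

variable {σ : Strategy.{u}} {N : ℕ} {ν : ℕ → ℕ}

/-! ## §1. Step projections along σ-steps -/

-- `StepProjectionσ σ N ν s s' f` («`f` is the blow-down of the σ-step») is res-type-012's (`…Corridor3SigmaIsoDefs`, p523704); reused.

/-- Every σ-step has a step projection. [folklore] -/
theorem CanonicalNearStepσ.exists_stepProjectionσ {s s' : MarkedStage.{u}} (h : CanonicalNearStepσ σ N ν s s') :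
    ∃ f : s'.W ⟶ s.W, StepProjectionσ σ N ν s s' f := by
  obtain ⟨C, P', hln, x', hcs, hπ, hcl, hx', rfl⟩ := h
  exact ⟨blowup.π C, C, P', hln, x', hcs, hπ, hcl, hx', rfl, by simp⟩

namespace StepProjectionσ

variable {s s' : MarkedStage.{u}} {f g : s'.W ⟶ s.W}

/-- A step projection presents a σ-step. [folklore] -/
theorem canonicalNearStepσ (hf : StepProjectionσ σ N ν s s' f) : CanonicalNearStepσ σ N ν s s' := by
  obtain ⟨C, P', hln, x', hcs, hπ, hcl, hx', e, -⟩ := hf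
  exact ⟨C, P', hln, x', hcs, hπ, hcl, hx', e⟩

/-- **The step projection maps the marked point to the marked point.** [folklore] -/
theorem base_pt (hf : StepProjectionσ σ N ν s s' f) : f.base s'.pt = s.pt := by
  obtain ⟨C, P', hln, x', -, hπ, -, -, e, rfl⟩ := hf
  subst e
  simpa using hπ

/-- The marked point of the target lies in the `ν`-stratum. [folklore] -/
theorem pt_mem_hsStratum (hf : StepProjectionσ σ N ν s s' f) : s'.pt ∈ Scheme.hsStratum s'.W N ν :=
  hf.canonicalNearStepσ.pt_mem_hsStratum

/-- **For a FUNCTIONAL strategy the step projection is unique** (the centre is unique). [folklore] -/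
theorem unique (hσ : σ.IsFunctional N ν) (hf : StepProjectionσ σ N ν s s' f) (hg : StepProjectionσ σ N ν s s' g) : f = g := by
  obtain ⟨C₁, P₁, h₁, x₁, hcs₁, -, -, -, e₁, rfl⟩ := hf
  obtain ⟨C₂, P₂, h₂, x₂, hcs₂, -, -, -, e₂, rfl⟩ := hg
  obtain rfl : C₁ = C₂ := (hσ s.W s.ln s.L s.P).1 C₁ C₂ P₁ P₂ hcs₁ hcs₂
  rfl

/-- **Domination continues a lineage through the chain points** (σ-copy). [cite: CossartJannsenSaito2020, Rem. 6.29 (1)] -/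
theorem closure_image_mem_componentsThrough (hf : StepProjectionσ σ N ν s s' f) {Z' : Set s'.W}
    (hZ' : Z' ∈ componentsThrough N ν s') (hdom : closure (f.base '' Z') ∈ componentsIn (Scheme.hsStratum s.W N ν)) :
    closure (f.base '' Z') ∈ componentsThrough N ν s :=
  ⟨hdom, subset_closure ⟨s'.pt, hZ'.2, hf.base_pt⟩⟩

end StepProjectionσ

/-! ## §2. Marked points in the strata, Noetherian stages along σ-chains -/

/-- Finite type over a field propagates along a σ-step (blow-ups are proper). [cite: GortzWedhorn2020, Prop. 13.96 (1)] -/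
theorem exists_overField_of_canonicalNearStepσ {k : Type u} [Field k] {s s' : MarkedStage.{u}}
    (h : ∃ f : s.W ⟶ Spec (.of k), LocallyOfFiniteType f ∧ QuasiCompact f) (hst : CanonicalNearStepσ σ N ν s s') :
    ∃ f : s'.W ⟶ Spec (.of k), LocallyOfFiniteType f ∧ QuasiCompact f := by
  obtain ⟨C, P', hln, x', -, -, -, -, rfl⟩ := hst
  obtain ⟨f, hf, hq⟩ := h
  haveI := s.ln
  haveI : IsProper (blowup.π C) := (blowup.isBlowup C).isProper
  exact ⟨blowup.π C ≫ f, inferInstance, inferInstance⟩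

/-- … and along `Reachesσ`. [folklore] -/
theorem exists_overField_of_reachesσ {k : Type u} [Field k] {s s' : MarkedStage.{u}}
    (h : ∃ f : s.W ⟶ Spec (.of k), LocallyOfFiniteType f ∧ QuasiCompact f) (hr : Reachesσ σ N ν s s') :
    ∃ f : s'.W ⟶ Spec (.of k), LocallyOfFiniteType f ∧ QuasiCompact f := by
  induction hr with
  | refl => exact h
  | tail _ hlast ih => exact exists_overField_of_canonicalNearStepσ ih hlast

/-- **Every stage σ-reached from a maximal origin is a Noetherian scheme.** [cite: GortzWedhorn2020, Prop. 13.96 (1)] -/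
theorem isNoetherian_of_reachesσ_init {p : ℕ} {X : Scheme.{u}} [IsLocallyNoetherian X] {x : X}
    (hX : IsMaximalOrigin p N ν X x) {s : MarkedStage.{u}} (hr : Reachesσ σ N ν (MarkedStage.init X x) s) :
    IsNoetherian s.W := by
  obtain ⟨k, _, _, f, -, hft, hqc⟩ := hX.exists_structure
  obtain ⟨g, hg, hq⟩ := exists_overField_of_reachesσ (k := k) (s := MarkedStage.init X x) ⟨f, hft, hqc⟩ hr
  exact Scheme.isNoetherian_of_finiteType_over_field g

/-- Reachability along a chain of σ-steps (local copy of res-type-012's `reachesσ_chain`, to keep this file free of the iso rows). [folklore] -/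
private theorem reachesσ_chain' {s₀ : MarkedStage.{u}} {c : ℕ → MarkedStage.{u}} (h0 : Reachesσ σ N ν s₀ (c 0))
    (hstep : ∀ n, CanonicalNearStepσ σ N ν (c n) (c (n + 1))) : ∀ n, Reachesσ σ N ν s₀ (c n)
  | 0 => h0
  | n + 1 => (reachesσ_chain' h0 hstep n).tail (hstep n)

/-! ## §3. Rows (b)σ, (c)σ and the Kőnig reduction -/

/-- [OURS · L1 W4.2] **ROW (b)σ — BIRTHS THROUGH THE CHAIN POINTS SETTLE, under the strategy σ** (σ-copy of stub-4's `StrataBirthsSettle`: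
the oracle binder is replaced by the strategy parameter). OURS row; NOT a statement of the manuscript. [folklore] -/
def StrataBirthsSettleσ (σ : Strategy.{u}) (p N : ℕ) (Q : ℕ → (ℕ → ℕ) → ∀ X : Scheme.{u}, X → Prop)
    (G : MarkedStage.{u} → Prop) : Prop :=
  ∀ (ν : ℕ → ℕ) (X : Scheme.{u}) [IsLocallyNoetherian X] (x : X), IsMaximalOrigin p N ν X x → Q N ν X x →
  ∀ c : ℕ → MarkedStage.{u}, Reachesσ σ N ν (MarkedStage.init X x) (c 0) →
    (∀ n, CanonicalNearStepσ σ N ν (c n) (c (n + 1))) → (∀ n, G (c n)) → (∀ n, ¬ Iso N (c n)) →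
    (∀ n, ∃ m, n ≤ m ∧ (c m).IsBlownUpσ σ N ν) →
    ∃ n₁, ∀ n, n₁ ≤ n → ∀ f : (c (n + 1)).W ⟶ (c n).W, StepProjectionσ σ N ν (c n) (c (n + 1)) f →
      ∀ Z' ∈ componentsThrough N ν (c (n + 1)),
        closure (f.base '' Z') ∈ componentsIn (Scheme.hsStratum (c n).W N ν)

/-- [OURS · L1 W4.2] **ROW (c)σ — NO INFINITE LINEAGE THROUGH THE CHAIN POINTS, under σ** (σ-copy of `StrataLineagesFinite`). OURS row; NOT a
statement of the manuscript. [folklore] -/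
def StrataLineagesFiniteσ (σ : Strategy.{u}) (p N : ℕ) (Q : ℕ → (ℕ → ℕ) → ∀ X : Scheme.{u}, X → Prop)
    (G : MarkedStage.{u} → Prop) : Prop :=
  ∀ (ν : ℕ → ℕ) (X : Scheme.{u}) [IsLocallyNoetherian X] (x : X), IsMaximalOrigin p N ν X x → Q N ν X x →
  ∀ c : ℕ → MarkedStage.{u}, Reachesσ σ N ν (MarkedStage.init X x) (c 0) →
    (∀ n, CanonicalNearStepσ σ N ν (c n) (c (n + 1))) → (∀ n, G (c n)) → (∀ n, ¬ Iso N (c n)) →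
    (∀ n, ∃ m, n ≤ m ∧ (c m).IsBlownUpσ σ N ν) →
    ¬ ∃ Z : ∀ n, Set (c n).W, (∀ n, Z n ∈ componentsThrough N ν (c n)) ∧
        ∀ n, ∃ f : (c (n + 1)).W ⟶ (c n).W, StepProjectionσ σ N ν (c n) (c (n + 1)) f ∧
          closure (f.base '' Z (n + 1)) = Z n

/-- **THE STRATA-HALF UNDER σ REDUCED TO (b)σ AND (c)σ — PROVED (Kőnig on the lineages through the chain points; verbatim stub-4's p500484
argument, which never used the CJS strategy).** [cite: CossartJannsenSaito2020, Rem. 6.29 (1), p. 105] -/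
theorem maxOriginNoMovingNearChainAtQσ_notIso_of_lineages {p N : ℕ} {Q : ℕ → (ℕ → ℕ) → ∀ X : Scheme.{u}, X → Prop}
    {G : MarkedStage.{u} → Prop} (hB : StrataBirthsSettleσ σ p N Q G) (hC : StrataLineagesFiniteσ σ p N Q G) :
    MaxOriginNoMovingNearChainAtQσ σ p N Q fun s => G s ∧ ¬ Iso N s := by
  intro ν X _ x hX hQ
  rintro ⟨c, h0, hstep, hG, hmov⟩
  obtain ⟨n₁, hn₁⟩ := hB ν X x hX hQ c h0 hstep (fun n => (hG n).1) (fun n => (hG n).2) hmov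
  let c' : ℕ → MarkedStage.{u} := fun n => c (n₁ + n)
  have h0' : Reachesσ σ N ν (MarkedStage.init X x) (c' 0) := reachesσ_chain' h0 hstep n₁
  have hstep' : ∀ n, CanonicalNearStepσ σ N ν (c' n) (c' (n + 1)) := fun n => hstep (n₁ + n)
  have hN : ∀ n, IsNoetherian (c' n).W := fun n => isNoetherian_of_reachesσ_init hX (reachesσ_chain' h0' hstep' n)
  have hproj : ∀ n, ∃ f : (c' (n + 1)).W ⟶ (c' n).W, StepProjectionσ σ N ν (c' n) (c' (n + 1)) f :=
    fun n => (hstep' n).exists_stepProjectionσ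
  choose f hf using hproj
  have hdom : ∀ n, ∀ Z' ∈ componentsThrough N ν (c' (n + 1)),
      closure ((f n).base '' Z') ∈ componentsThrough N ν (c' n) := fun n Z' hZ' =>
    (hf n).closure_image_mem_componentsThrough hZ' (hn₁ (n₁ + n) (Nat.le_add_right _ _) (f n) (hf n) Z' hZ')
  let F : ℕ → Type u := fun n => ↥(componentsThrough N ν (c' n))
  haveI : ∀ n, Finite (F n) := fun n => by
    haveI := hN n
    exact (componentsThrough_finite (N := N) (ν := ν) (c' n)).to_subtype
  haveI : ∀ n, Nonempty (F n) := fun n =>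
    (componentsThrough_nonempty
      (pt_mem_hsStratum_of_reachesσ (reachesσ_chain' h0' hstep' n) hX.mem_stratum)).to_subtype
  obtain ⟨u, hu⟩ := exists_section_of_finite_nonempty (F := F)
    fun n Z' => ⟨closure ((f n).base '' Z'.1), hdom n Z'.1 Z'.2⟩
  exact hC ν X x hX hQ c' h0' hstep' (fun n => (hG _).1) (fun n => (hG _).2) (io_shift hmov n₁)
    ⟨fun n => (u n).1, fun n => (u n).2, fun n => ⟨f n, hf n, congrArg Subtype.val (hu n)⟩⟩

/-! ## §4. Transport back to stub-4's rows (`Iff.rfl`-grade) -/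

/-- Row (b) is row (b)σ for every CJS strategy. [folklore] -/
theorem strataBirthsSettle_iff_forall_cjs {p N : ℕ} {Q : ℕ → (ℕ → ℕ) → ∀ X : Scheme.{u}, X → Prop} {G : MarkedStage.{u} → Prop} :
    StrataBirthsSettle p N Q G ↔
      ∀ R : ∀ S : Scheme.{u}, CentreSeq S → Prop, OracleFunctional R → OracleAdmissible R →
        StrataBirthsSettleσ (Strategy.cjs R) p N Q G :=
  Iff.rfl

/-- Row (c) is row (c)σ for every CJS strategy. [folklore] -/
theorem strataLineagesFinite_iff_forall_cjs {p N : ℕ} {Q : ℕ → (ℕ → ℕ) → ∀ X : Scheme.{u}, X → Prop} {G : MarkedStage.{u} → Prop} :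
    StrataLineagesFinite p N Q G ↔
      ∀ R : ∀ S : Scheme.{u}, CentreSeq S → Prop, OracleFunctional R → OracleAdmissible R →
        StrataLineagesFiniteσ (Strategy.cjs R) p N Q G :=
  Iff.rfl

end Summit.ResolutionOfSingularities.ResolutionOfSingularities.Theorems.SigmaMaxModificationsCorridor3.Sigma

end
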